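import Mathlib
import Summits.MatrixMultiplication.MatrixMultiplication.Theorems.LevelGradedCohnUmansLevelOneGL2DesignsTangencyNormPencil

/-!
# Norm-form ("unitary circle") pencils, II: rigidity — stub `stub_tangencySets`
(crux `LevelOneGL2Designs`, stmt-MatrixMultiplication-14080), wall-breaker axis 10/12
*Hermitian unital constructions*, generation 1

Part I (`…TangencyNormPencil`) showed that the levels `C_r = {x² − d y² = r}`, `r ∈ R`, with their
level tangents form a strong representative system as soon as `R ⊆ 𝔽_pˣ` is a *norm-clique*
(`d·r(r − r')` a non-square for `r ≠ r'`).  This file proves that the condition is NECESSARY, for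
tangents in ARBITRARY position:

* `normPencil_rigidity` — if `p` is odd, `R ⊆ 𝔽_pˣ`, and every point of the union of levels
  `X_R = {v : Q v ∈ R}` carries some line meeting `X_R` only there, then `R` is a norm-clique.
  Restrict `Q` to the line through `v ∈ C_r` with direction `w`: `Q(v + s w) = r + 2sβ + s²γ`;
  an asymptotic direction (`γ = 0`) has `β ≠ 0` and reaches the level `r'`; a secant direction
  (`γ ≠ 0 ≠ β`) returns to `C_r` at `s = −2β/γ`; so the line is the level tangent (`β = 0`),
  `−rγ = d c²` with `c ≠ 0`, and a square root `t` of `d r (r − r')` puts the point `s = t/(dc)`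
  of the line on `C_{r'}`.
* `normPencil_isTangencySet_iff` — hence, for `p` odd and `R ⊆ 𝔽_pˣ`: `X_R` is an affine
  tangency set iff `R` is a norm-clique (the unitary analogue of
  `…TangencyParabolaLift.parabolaPencil_isTangencySet_iff` for parabola pencils).

Part III (`…TangencyNormPencilCeiling`) bounds norm-cliques: `|R| ≤ 2` if `p ≡ 3 (mod 4)`, a Paley
clique or coclique if `p ≡ 1 (mod 4)`, `|R|² ≤ p + 1` always.  RELATION TO THE SIBLING FILE
`…StubTangencySetsHermitianCircles` (axis-1 seat, landed the same hour): its
`isSquare_of_privateLine` is the circle case (`d` a non-square, where every direction is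
anisotropic); the present theorem covers every `d ≠ 0`, in particular the hyperbola pencils, whose
two asymptotic directions through each point are the additional case of the proof.
Elementary; Mathlib plus part I; no new definitions.
-/

set_option linter.dupNamespace false

namespace Summit.MatrixMultiplication.MatrixMultiplication.Theorems.LevelOneGL2Designs.NormPencil

open Finset Matrix

variable {p : ℕ} [Fact p.Prime]

/-! ## Rigidity: a union of at least two levels has no tangents other than the level tangents -/

/-- **Rigidity of norm-form pencils.**  Let `p` be odd, `d ≠ 0`, `R ⊆ 𝔽_p ∖ {0}`, and suppose the
point set `X_R = {v : v₀² − d v₁² ∈ R}` is an affine tangency set: every `v ∈ X_R` carries SOME line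
`{w : u ⬝ᵥ w = u ⬝ᵥ v}` (`u ≠ 0`, in arbitrary position) meeting `X_R` only in `v`.  Then
`d·r(r − r')` is a non-square for all `r ≠ r'` in `R` — the hypothesis of `normPencil_srs` is also
NECESSARY.  Proof: restrict `Q` to the line through `v ∈ C_r` with direction `w`:
`Q(v + s w) = r + 2sβ + s²γ`.  If `γ = Q(w) = 0` (an asymptotic direction) then `β ≠ 0` and `Q`
takes the value `r'` on the line; if `γ ≠ 0 ≠ β` the line meets `C_r` again at `s = −2β/γ`; so the
line is the `Q`-tangent (`β = 0`), and then `−rγ = d c²` with `c ≠ 0`, and a square root `t` of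
`d r (r − r')` puts the point `s = t/(dc)` of the line on `C_{r'}`. [elementary] -/
theorem normPencil_rigidity (d : ZMod p) (hd : d ≠ 0) (hp2 : p ≠ 2) (R : Finset (ZMod p))
    (hR0 : (0 : ZMod p) ∉ R)
    (htan : ∀ v : Fin 2 → ZMod p, v 0 ^ 2 - d * v 1 ^ 2 ∈ R →
      ∃ u : Fin 2 → ZMod p, u ≠ 0 ∧ ∀ w : Fin 2 → ZMod p, w 0 ^ 2 - d * w 1 ^ 2 ∈ R →
        u ⬝ᵥ w = u ⬝ᵥ v → w = v) :
    ∀ r ∈ R, ∀ r' ∈ R, r ≠ r' → ¬ IsSquare (d * (r * (r - r'))) := by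
  classical
  intro r hr r' hr' hne hsq
  have hr0 : r ≠ 0 := fun h => hR0 (h ▸ hr)
  have h2 : (2 : ZMod p) ≠ 0 := Ring.two_ne_zero (by rw [ZMod.ringChar_zmod_n]; exact hp2)
  obtain ⟨a, b, hab⟩ := exists_norm_eq d hd hp2 r
  obtain ⟨u, hu0, hu⟩ := htan ![a, b] (by simpa [hab] using hr)
  -- the restriction of `Q` to the line `s ↦ (a + s u₁, b − s u₀)` through `(a,b)`
  set β := a * u 1 + d * (b * u 0) with hβ
  set γ := u 1 ^ 2 - d * u 0 ^ 2 with hγ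
  have hline : ∀ s : ZMod p, (a + s * u 1) ^ 2 - d * (b - s * u 0) ^ 2 ∈ R → s = 0 := by
    intro s hs
    have hw := hu ![a + s * u 1, b - s * u 0] (by simpa using hs) (by
      simp only [dotProduct, Fin.sum_univ_two, Matrix.cons_val_zero, Matrix.cons_val_one,
        Matrix.cons_val_fin_one]
      ring)
    have e0 : s * u 1 = 0 := by
      have h0 := congrFun hw 0
      simp only [Matrix.cons_val_zero] at h0
      linear_combination h0
    have e1 : s * u 0 = 0 := by
      have h1 := congrFun hw 1
      simp only [Matrix.cons_val_one, Matrix.cons_val_fin_one] at h1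
      linear_combination -h1
    by_contra hs0
    apply hu0
    funext i
    fin_cases i
    · exact (mul_eq_zero.1 e1).resolve_left hs0
    · exact (mul_eq_zero.1 e0).resolve_left hs0
  have hQ : ∀ s : ZMod p,
      (a + s * u 1) ^ 2 - d * (b - s * u 0) ^ 2 = r + 2 * s * β + s ^ 2 * γ := by
    intro s
    rw [hβ, hγ, ← hab]
    ring
  have hpol : β ^ 2 - r * γ = d * (a * u 0 + u 1 * b) ^ 2 := by
    rw [hβ, hγ, ← hab]
    ring
  by_cases hγ0 : γ = 0
  · -- asymptotic direction: `Q` is affine along the line and reaches `r'`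
    have hβ0 : β ≠ 0 := by
      intro hβ0
      have hc : a * u 0 + u 1 * b = 0 := by
        have h3 : d * (a * u 0 + u 1 * b) ^ 2 = 0 := by rw [← hpol, hβ0, hγ0]; ring
        exact (pow_eq_zero_iff two_ne_zero).1 ((mul_eq_zero.1 h3).resolve_left hd)
      have hβ0' : a * u 1 + d * (b * u 0) = 0 := hβ0
      have e0 : (a ^ 2 - d * b ^ 2) * u 0 = 0 := by linear_combination a * hc - b * hβ0'
      have e1 : (a ^ 2 - d * b ^ 2) * u 1 = 0 := by
        linear_combination a * hβ0' - (d * b) * hc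
      rw [hab] at e0 e1
      apply hu0
      funext i
      fin_cases i
      · exact (mul_eq_zero.1 e0).resolve_left hr0
      · exact (mul_eq_zero.1 e1).resolve_left hr0
    set s := (r' - r) / (2 * β) with hs
    have hsβ : s * (2 * β) = r' - r := by rw [hs]; field_simp
    have hval : (a + s * u 1) ^ 2 - d * (b - s * u 0) ^ 2 = r' := by
      rw [hQ, hγ0]
      linear_combination hsβ
    have hs0 := hline s (hval ▸ hr')
    rw [hs0, zero_mul] at hsβ
    exact hne (by linear_combination hsβ)
  · by_cases hβ0 : β = 0
    · -- the line is the `Q`-tangent: use the square root of `d r (r - r')`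
      obtain ⟨t, ht⟩ := hsq
      set c := a * u 0 + u 1 * b with hc
      have hpol0 : d * c ^ 2 + r * γ = 0 := by
        rw [hβ0] at hpol
        linear_combination -hpol
      have hc0 : c ≠ 0 := by
        intro h0
        rw [h0] at hpol0
        have h3 : r * γ = 0 := by linear_combination hpol0
        exact mul_ne_zero hr0 hγ0 h3
      have hdc : d * c ≠ 0 := mul_ne_zero hd hc0
      set s := t / (d * c) with hs
      have hdcs : d * c * s = t := by rw [hs]; field_simp
      have ht' : t ^ 2 = d * (r * (r - r')) := by rw [sq]; exact ht.symm
      have hsq' : (d * c) ^ 2 * (s ^ 2 * γ) = (d * c) ^ 2 * (r' - r) := by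
        calc (d * c) ^ 2 * (s ^ 2 * γ) = (d * c * s) ^ 2 * γ := by ring
          _ = t ^ 2 * γ := by rw [hdcs]
          _ = (d * c) ^ 2 * (r' - r) := by
              linear_combination γ * ht' + (d * (r - r')) * hpol0
      have hs2 : s ^ 2 * γ = r' - r := mul_left_cancel₀ (pow_ne_zero 2 hdc) hsq'
      have hval : (a + s * u 1) ^ 2 - d * (b - s * u 0) ^ 2 = r' := by
        rw [hQ, hβ0, hs2]
        ring
      have hs0 := hline s (hval ▸ hr')
      rw [hs0, mul_zero] at hdcs
      rw [← hdcs, mul_zero] at ht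
      exact mul_ne_zero hd (mul_ne_zero hr0 (sub_ne_zero.2 hne)) ht
    · -- secant direction: the line meets the level `r` again at `s = -2β/γ ≠ 0`
      set s := -(2 * β) / γ with hs
      have hsγ : s * γ = -(2 * β) := by rw [hs]; field_simp
      have hval : (a + s * u 1) ^ 2 - d * (b - s * u 0) ^ 2 = r := by
        rw [hQ]
        linear_combination s * hsγ
      have hs0 := hline s (hval ▸ hr)
      rw [hs0, zero_mul] at hsγ
      exact mul_ne_zero h2 hβ0 (by linear_combination hsγ)

/-! ## The tangency-set dichotomy -/

/-- **The tangency-set dichotomy for norm-form pencils** (packaging).  For `p` odd, `d ≠ 0` and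
`R ⊆ 𝔽_p ∖ {0}`, the union of levels `X_R = {v : v₀² − d v₁² ∈ R}` is an affine tangency set
(every point carries a line, in arbitrary position, meeting `X_R` only there) if and only if `R`
is a norm-clique for `d`.  (`→`: `normPencil_rigidity`; `←`: the level tangents of
`normPencil_srs`, whose normal vectors are non-zero because `Q v ≠ 0`.)  With part III
this pins the architecture: circles (or hyperbolas) with a common centre form a tangency set only
along a norm-clique of levels, of order at most `√(p+1)`. [elementary] -/
theorem normPencil_isTangencySet_iff (d : ZMod p) (hd : d ≠ 0) (hp2 : p ≠ 2) (R : Finset (ZMod p))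
    (hR0 : (0 : ZMod p) ∉ R) :
    (∀ v : Fin 2 → ZMod p, v 0 ^ 2 - d * v 1 ^ 2 ∈ R →
      ∃ u : Fin 2 → ZMod p, u ≠ 0 ∧ ∀ w : Fin 2 → ZMod p, w 0 ^ 2 - d * w 1 ^ 2 ∈ R →
        u ⬝ᵥ w = u ⬝ᵥ v → w = v) ↔
    ∀ r ∈ R, ∀ r' ∈ R, r ≠ r' → ¬ IsSquare (d * (r * (r - r'))) := by
  classical
  refine ⟨normPencil_rigidity d hd hp2 R hR0, fun hR v hv => ?_⟩
  obtain ⟨r, hr⟩ : ∃ r, v 0 ^ 2 - d * v 1 ^ 2 = r := ⟨_, rfl⟩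
  rw [hr] at hv
  have hr0 : r ≠ 0 := fun h => hR0 (h ▸ hv)
  refine ⟨![v 0, -(d * v 1)], ?_, ?_⟩
  · intro h0
    have ha : v 0 = 0 := by simpa using congrFun h0 0
    have hb : d * v 1 = 0 := by simpa using congrFun h0 1
    have hb' : v 1 = 0 := (mul_eq_zero.1 hb).resolve_left hd
    apply hr0
    rw [← hr, ha, hb']
    ring
  · intro w hw hB
    obtain ⟨r', hr'⟩ : ∃ r', w 0 ^ 2 - d * w 1 ^ 2 = r' := ⟨_, rfl⟩
    rw [hr'] at hw
    have hBv : (![v 0, -(d * v 1)] : Fin 2 → ZMod p) ⬝ᵥ v = r := by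
      rw [← hr]
      simp [dotProduct, Fin.sum_univ_two]
      ring
    have hBw : (![v 0, -(d * v 1)] : Fin 2 → ZMod p) ⬝ᵥ w = v 0 * w 0 - d * (v 1 * w 1) := by
      simp [dotProduct, Fin.sum_univ_two]
      ring
    rw [hBv, hBw] at hB
    -- `B(v,w) = r = Q v`: polar identity gives `r (r - r') = d (v × w)²`-type relation
    have hpol := polar_sq_sub_norm_mul_norm d (v 0) (v 1) (w 0) (w 1)
    rw [hr, hr', hB] at hpol
    -- hpol : r ^ 2 - r * r' = d * (v 0 * w 1 - w 0 * v 1) ^ 2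
    have hrr : r' = r := by
      by_contra hne
      refine hR r hv r' hw (Ne.symm hne) ⟨d * (v 0 * w 1 - w 0 * v 1), ?_⟩
      linear_combination d * hpol
    have hcross : d * (v 0 * w 1 - w 0 * v 1) ^ 2 = 0 := by
      rw [← hpol, hrr]
      ring
    have hc : v 0 * w 1 - w 0 * v 1 = 0 := by
      rcases mul_eq_zero.1 hcross with h | h
      · exact absurd h hd
      · exact (pow_eq_zero_iff two_ne_zero).1 h
    rw [hrr] at hr'
    have h0 : w 0 * r = v 0 * r := by
      linear_combination (-(w 0)) * hr + (v 0) * hB + (d * v 1) * hc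
    have h1 : w 1 * r = v 1 * r := by
      linear_combination (-(w 1)) * hr + (v 1) * hB + (v 0) * hc
    funext i
    fin_cases i
    · exact mul_right_cancel₀ hr0 h0
    · exact mul_right_cancel₀ hr0 h1


end Summit.MatrixMultiplication.MatrixMultiplication.Theorems.LevelOneGL2Designs.NormPencil
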